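import Summits.PneNP.PneNP.Theses.RootDecompSpaceCeiling
import Summits.PneNP.PneNP.Theses.RootDecompQuantumCell
import Literature.Computability.Complexity.Classes
import Literature.Computability.Complexity.Nondeterministic
import Literature.Computability.Complexity.NondeterministicProofs
import Literature.Computability.Complexity.ProbabilisticClasses
import Literature.Computability.Complexity.ProbabilisticClassesProofs
import Literature.Computability.Complexity.PolyHierarchy
import Literature.Computability.Complexity.SipserGacsLautemann
import Literature.Computability.Complexity.Counting
import Literature.Computability.Complexity.CountingHierarchyPH
import Literature.Computability.Complexity.Oracle
import Literature.Computability.Complexity.OracleEmpty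
import Literature.Computability.Complexity.OracleProofs
import Literature.Computability.Complexity.PRelHierarchy
import Literature.Computability.Complexity.BakerGillSolovay
import Literature.Computability.Cryptography.ClassBQP
import Literature.Computability.Cryptography.ClassBQPRelProofs
import Literature.Computability.QuantumComplexity.BQP
import Literature.Computability.QuantumComplexity.BQPSubsetPP
import Literature.Computability.QuantumComplexity.SimUniformity
import Literature.Computability.QuantumComplexity.CountingSimulation
import Literature.Computability.QuantumComplexity.CountingSimulationRel
import Literature.Computability.QuantumComplexity.CountingSimulationProofs
import Literature.Computability.QuantumComplexity.BQPSubsetAWPP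
import Literature.Computability.QuantumComplexity.AccGapMachine
import Literature.Computability.QuantumComplexity.AWPPLowForPP
import Literature.Barriers.PneNP.Relativization
import Literature.Barriers.QuantumAdvantage.Relativization

/-!
# `RootDecompSpaceCeiling.CollapseLift` (stmt-PneNP-23703) — the COUNTING SANDWICH of the hub residual K, and its quantum cell over `RootDecompQuantumCell.QLift` (stmt-PneNP-29732)

Support file (S-free; it closes no item and defines no proposition) for the hub residual of the
decomp-pnenp root-decomposition cell, `K = RootDecompSpaceCeiling.CollapseLift := NP ⊆ P → PP ⊆ P`
(route `route-PneNP-RootDecompSpaceCeiling`), and for N19's residual `RootDecompQuantumCell.QLift :=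
NP ⊆ P → BQP ⊆ P` (route `route-PneNP-RootDecompQuantumCell`). Port of the lens-4 kernel «CountingSandwich»
(HOME/decomp-pnenp-lens-4/CountingSandwich.lean, g13 sha256 be3d77d5…, critic NODE-VERDICT 2026-08-30T11:28:01Z
CLEARED as located hub K-cell #4; g14 revision CountingSandwich-g14.lean), restated over the route
declarations BY NAME — K, `QLift`, and N19's record asides `QCatch` (stmt-PneNP-32697), `TQC`/`TQL`/`TQI`
(32698/32699/32700), `AWCatch` (32701) filed by writer g7 — with every other lens proposition written out (no
`def … : Prop` under `Summits/`) and the relativized ledger phrased as SETS OF WORLDS (language oracles).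
g14 DELTA over the filed record: the tests `TQC` and `TQI` are DECIDED TRUE in print — Aaronson–Ingram–Kretschmer
2022 Thm 4 («P = NP but BQP ≠ QCMA», Cor. 45 p. 25) read through Cor. 43 / Claim 44 (p. 24: `L^A ∈ NP^{M^A}`,
`M^A ∈ BQP^A`) gives a collapsing world with BQP STRICTLY INTERMEDIATE (`thm4_decides_tests`, `ff_row`); `TQL`
(«P = NP = BQP ≠ PP», AIK22 §6) stays the one open test of the cell; `T_AWC` is typed (`tAWC_iff`, `awTest_subset_qTest`).

CONTENT (this file = Part A: §§0–4, definition-free; §§5–7 — the world-set ledger and the two print-binder sections — are deferred to a companion Part B file because of the 400-line limit for Theorems proof files).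
§1 For a class `𝒞` with `P ⊆ 𝒞 ⊆ PP` the hub splits EXACTLY: `K ⟺ (NP ⊆ P → 𝒞 ⊆ P) ∧ (NP ⊆ P → PP ⊆ 𝒞)`
   («Algorithmica collapses 𝒞» ∧ «in Algorithmica 𝒞 catches counting»); costume laws (one side a theorem ⇒ the
   other side IS K). §2 Inside `PH` the lift is a theorem (Meyer–Stockmeyer; Sipser–Gács–Lautemann), so the
   `BPP` and `PH` cells are costume. §3 The quantum cell `K ⟺ QLift ∧ (NP ⊆ P → PP ⊆ BQP)` — hypothesis-free over
   the tree theorems `P ⊆ BQP ⊆ PP`; N19's aside `BQPInPH` reaches the lift. §4 The `AWPP` twin, hypothesis-free over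
   the tree's Fortnow–Rogers theorems; the AWPP catch collapses `PP^PP` to `PP` inside Algorithmica (lowness).
§5 World sets: `collapseWorlds`, `kWorlds`, `liftWorlds 𝒞`, `catchWorlds 𝒞` ⊆ `Language Bool`; relativized glue
   and failure pattern as inclusions; hypothesis-free non-emptiness from the Baker–Gill–Solovay world; the PHASE LAW
   `catchWorlds 𝒞 = kWorlds` for `P ⊆ 𝒞 ⊆ PH` relativizably; empty-oracle anchors to the two items.
§6 Modulo the PRINT BINDER «AIK22 Thm 10» (`P = NP ≠ BQP = P^{#P}` relative to an oracle; entered as an explicit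
   HYPOTHESIS, never as a fact): the BQP- and AWPP-catch hold in a collapsing world where K fails (strictly below K),
   the BQP-lift, the AWPP-lift and K have no relativizing proof. §7 Modulo the PRINT BINDER «AIK22 Thm 4 / Cor 45» (`P = NP ∧
   BQP ≠ QCMA`, read with Cor 43's languages `L^A ∈ NP^{M^A}`, `M^A ∈ BQP^A` and two relativizing closure steps):
   a collapsing world where `BQP ⊄ P` AND `PP ⊄ BQP` — so the BQP-catch has no relativizing proof either, the failure
   pattern (F,F) is realized, and the (T,F) row is exactly the open oracle question «P = NP = BQP ≠ PP»; the typed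
   AWPP test implies the BQP test; ZERO-SUM OF CERTIFICATES (critic): `collapseWorlds ∩ kWorldsᶜ ∩ catchWorlds 𝒞 ⊆
   (liftWorlds 𝒞)ᶜ`. Named-fact hypothesis where the proof module is not yet built on the farm:
   `PRel_ofLanguage_subset_BQPRel` (`P^B ⊆ BQP^B`; discharged in `CountingSimulationRelProofs.lean`).
0 sorry; axioms ⊆ {propext, Classical.choice, Quot.sound}.
[cite: AaronsonIngramKretschmer2022, Thm. 10 (p. 8), Thm. 4 (p. 6), Cor. 43–45 (pp. 24–25)]
[cite: FortnowRogers1999JCSS, Thm. 3.1, Thm. 3.3, Cor. 3.4] [cite: BernsteinVazirani1997SICOMP, Thm. 8.2]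
[cite: BakerGillSolovay1975, Thm. 1] [cite: AroraBarakCC2009, §3.4, Thm. 5.4, §17.2]
-/

namespace Summit.PneNP.PneNP.Theorems.RootDecompCountingSandwichPort

open Literature.Computability.Complexity
open Literature.Computability.Cryptography (BQP BQPRel)
open Literature.Computability.QuantumComplexity (AWPP AWPPRel)
open Literature.Barriers.PneNP (Relativizes)
open Literature.Barriers.QuantumAdvantage (bqpRelOf presentsBQPRel_bqpRelOf bqpRelOf_empty)
open Summit.PneNP.PneNP.Theses

/-! ## §0 Tree facts under short names -/

/-- `P ⊆ NP`. [cite: AroraBarakCC2009, §2.1] -/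
theorem p_subset_np : Classes.P ⊆ Nondeterministic.NP := P_subset_NP_holds

/-- `P ⊆ BPP`. [cite: AroraBarakCC2009, §7.1] -/
theorem p_subset_bpp : Classes.P ⊆ BPP := P_subset_BPP_holds

/-- `P ⊆ BQP` (Hadamard coins after `P ⊆ BPP`). [cite: BernsteinVazirani1997SICOMP, Thm. 8.2] -/
theorem p_subset_bqp : Classes.P ⊆ BQP :=
  p_subset_bpp.trans Literature.Computability.QuantumComplexity.BPP_subset_BQP_holds

/-- `BQP ⊆ PP` (Adleman–DeMarrais–Huang). [cite: AdlemanDeMarraisHuang1997, Thm.] -/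
theorem bqp_subset_pp : BQP ⊆ PP := Literature.Computability.QuantumComplexity.BQP_subset_PP_holds

/-- `BQP ⊆ AWPP`. [cite: Fenner2003, Cor. 3.2] -/
theorem bqp_subset_awpp : BQP ⊆ AWPP := Literature.Computability.QuantumComplexity.BQP_subset_AWPP_holds

/-- `AWPP ⊆ PP`. [cite: FennerFortnowKurtzLi2003IC, §5] -/
theorem awpp_subset_pp : AWPP ⊆ PP := Literature.Computability.QuantumComplexity.AWPP_subset_PP_holds

/-- `P ⊆ AWPP`. [cite: Fenner2003, Cor. 3.2] -/
theorem p_subset_awpp : Classes.P ⊆ AWPP := p_subset_bqp.trans bqp_subset_awpp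

/-- Relativized `BQP^B ⊆ AWPP^B` in the canonical presentation (tree theorem `BQPRel_subset_AWPPRel_holds`).
[cite: FortnowRogers1999JCSS, Thm. 3.1] -/
theorem bqpRelOf_subset_awppRel (B : Language Bool) :
    bqpRelOf (Oracle.ofLanguage B) ⊆ AWPPRel (Oracle.ofLanguage B) := by
  rw [presentsBQPRel_bqpRelOf B]
  exact Literature.Computability.QuantumComplexity.BQPRel_subset_AWPPRel_holds B

/-- `P^B ⊆ BQP^B` in the canonical presentation, from the named tree fact. [cite: BernsteinVazirani1997SICOMP, Thm. 8.2] -/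
theorem pRel_subset_bqpRelOf (hPB : Literature.Computability.QuantumComplexity.PRel_ofLanguage_subset_BQPRel)
    (B : Language Bool) : PRel (Oracle.ofLanguage B) ⊆ bqpRelOf (Oracle.ofLanguage B) := by
  rw [presentsBQPRel_bqpRelOf B]
  exact hPB B

-- `AWPP` is low for `PP`: the tree theorem `Literature.Computability.QuantumComplexity.AWPPLow.AWPP_low_PP`
-- [cite: FortnowRogers1999JCSS, Thm. 3.3] is used directly below (no local restatement).

/-- `PP^∅ = PP`. [cite: Gill1977, Def. 5.1] -/
theorem ppRel_empty : PPRel Oracle.empty = PP := by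
  rw [PPRel_eq, show PRel Oracle.empty = Classes.P from PRel_empty_holds]
  rfl

/-! ## §1 The sandwich: `K ⟺ «Algorithmica collapses 𝒞» ∧ «in Algorithmica 𝒞 catches counting»` for `P ⊆ 𝒞 ⊆ PP` -/

/-- K implies the lift of every class inside `PP`. [decomp-pnenp lens-4, 2026-08-30] -/
theorem lift_of_k {C : Set (Language Bool)} (hPP : C ⊆ PP) (hk : RootDecompSpaceCeiling.CollapseLift) :
    Nondeterministic.NP ⊆ Classes.P → C ⊆ Classes.P :=
  fun hc => hPP.trans (hk hc)

/-- K implies the catch of every class containing `P`. [decomp-pnenp lens-4, 2026-08-30] -/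
theorem catch_of_k {C : Set (Language Bool)} (hP : Classes.P ⊆ C) (hk : RootDecompSpaceCeiling.CollapseLift) :
    Nondeterministic.NP ⊆ Classes.P → PP ⊆ C :=
  fun hc => (hk hc).trans hP

/-- **THE SANDWICH** (exact, glue free of inclusions): `K ⟺ Lift 𝒞 ∧ Catch 𝒞` for `P ⊆ 𝒞 ⊆ PP`.
[decomp-pnenp lens-4, 2026-08-30] -/
theorem sandwich_iff {C : Set (Language Bool)} (hP : Classes.P ⊆ C) (hPP : C ⊆ PP) :
    RootDecompSpaceCeiling.CollapseLift ↔
      (Nondeterministic.NP ⊆ Classes.P → C ⊆ Classes.P) ∧ (Nondeterministic.NP ⊆ Classes.P → PP ⊆ C) :=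
  ⟨fun hk => ⟨lift_of_k hPP hk, catch_of_k hP hk⟩, fun h hc => (h.2 hc).trans (h.1 hc)⟩

/-- COSTUME LAW (lift side): if the lift of `𝒞 ⊇ P` is a theorem, the catch of `𝒞` IS K. [decomp-pnenp lens-4, 2026-08-30] -/
theorem costume_of_lift {C : Set (Language Bool)} (hP : Classes.P ⊆ C)
    (hL : Nondeterministic.NP ⊆ Classes.P → C ⊆ Classes.P) :
    (Nondeterministic.NP ⊆ Classes.P → PP ⊆ C) ↔ RootDecompSpaceCeiling.CollapseLift :=
  ⟨fun hK hc => (hK hc).trans (hL hc), catch_of_k hP⟩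

/-- COSTUME LAW (catch side): if the catch of `𝒞 ⊆ PP` is a theorem, the lift of `𝒞` IS K. [decomp-pnenp lens-4, 2026-08-30] -/
theorem costume_of_catch {C : Set (Language Bool)} (hPP : C ⊆ PP)
    (hK : Nondeterministic.NP ⊆ Classes.P → PP ⊆ C) :
    (Nondeterministic.NP ⊆ Classes.P → C ⊆ Classes.P) ↔ RootDecompSpaceCeiling.CollapseLift :=
  ⟨fun hL hc => (hK hc).trans (hL hc), lift_of_k hPP⟩

/-! ## §2 Calibration: inside `PH` the lift is a theorem, so the catch IS K -/

/-- Meyer–Stockmeyer: `P = NP ⟹ Σₖᵖ = P`. [cite: AroraBarakCC2009, Thm. 5.4] -/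
theorem sigmaP_eq_P_of_collapse (hPN : Classes.P = Nondeterministic.NP) : ∀ k : ℕ, SigmaP k = Classes.P
  | 0 => rfl
  | k + 1 => by
    rw [SigmaP_succ, PiP_eq_co, sigmaP_eq_P_of_collapse hPN k, show co Classes.P = Classes.P from co_P_holds]
    exact hPN.symm

/-- `NP ⊆ P ⟹ PH ⊆ P`. [cite: AroraBarakCC2009, Thm. 5.4] -/
theorem lift_PH (hc : Nondeterministic.NP ⊆ Classes.P) : PH ⊆ Classes.P := by
  have hPN : Classes.P = Nondeterministic.NP := Set.Subset.antisymm p_subset_np hc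
  intro L hL
  obtain ⟨k, hk⟩ := Set.mem_iUnion.1 hL
  rwa [sigmaP_eq_P_of_collapse hPN k] at hk

/-- `P ⊆ PH`. [cite: AroraBarakCC2009, Def. 5.3] -/
theorem p_subset_ph : Classes.P ⊆ PH := fun L hL => Set.mem_iUnion.2 ⟨0, show L ∈ SigmaP 0 from hL⟩

/-- CALIBRATION (PH): «in Algorithmica PP ⊆ PH» IS K. [cite: AroraBarakCC2009, Thm. 5.4 and §17.4] -/
theorem catch_PH_iff_K : (Nondeterministic.NP ⊆ Classes.P → PP ⊆ PH) ↔ RootDecompSpaceCeiling.CollapseLift :=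
  costume_of_lift p_subset_ph (fun hc => lift_PH hc)

/-- `NP ⊆ P ⟹ BPP ⊆ P` (Sipser–Gács–Lautemann inside Algorithmica). [cite: AroraBarakCC2009, Thm. 7.15] -/
theorem lift_BPP (hc : Nondeterministic.NP ⊆ Classes.P) : BPP ⊆ Classes.P :=
  BPP_subset_SigmaP_two.trans ((SigmaP_subset_PH 2).trans (lift_PH hc))

/-- CALIBRATION (BPP): «in Algorithmica PP ⊆ BPP» IS K. [cite: AroraBarakCC2009, Thm. 7.15] -/
theorem catch_BPP_iff_K : (Nondeterministic.NP ⊆ Classes.P → PP ⊆ BPP) ↔ RootDecompSpaceCeiling.CollapseLift :=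
  costume_of_lift p_subset_bpp (fun hc => lift_BPP hc)

/-! ## §3 The quantum cell: `K ⟺ QLift ∧ «NP ⊆ P → PP ⊆ BQP»` (hypothesis-free) -/

/-- **THE QUANTUM CELL, EXACT**: `K ⟺ QLift ∧ (NP ⊆ P → PP ⊆ BQP)`, over the tree theorems `P ⊆ BQP ⊆ PP`.
[cite: AdlemanDeMarraisHuang1997, Thm.] [cite: BernsteinVazirani1997SICOMP, Thm. 8.2] -/
theorem quantumSandwich_iff : RootDecompSpaceCeiling.CollapseLift ↔
    RootDecompQuantumCell.QLift ∧ RootDecompQuantumCell.QCatch :=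
  sandwich_iff p_subset_bqp bqp_subset_pp

/-- Given `QLift`, K IS the quantum catch (neither piece is costume unless the other is a theorem).
[cite: BernsteinVazirani1997SICOMP, Thm. 8.2] -/
theorem k_iff_qCatch_of_qLift (hL : RootDecompQuantumCell.QLift) :
    RootDecompSpaceCeiling.CollapseLift ↔ RootDecompQuantumCell.QCatch :=
  (costume_of_lift p_subset_bqp hL).symm

/-- Dually, given the quantum catch, K IS `QLift`. [cite: AdlemanDeMarraisHuang1997, Thm.] -/
theorem k_iff_qLift_of_qCatch (hC : RootDecompQuantumCell.QCatch) :
    RootDecompSpaceCeiling.CollapseLift ↔ RootDecompQuantumCell.QLift :=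
  (costume_of_catch bqp_subset_pp hC).symm

/-- N19's S-free road reaches the lift: `BQP ⊆ PH` gives «NP ⊆ P → BQP ⊆ P» (the body of `QLift`, aside stmt-PneNP-29734).
[cite: AaronsonIngramKretschmer2022, §1.1] -/
theorem bqp_subset_P_of_bqpInPH (h : RootDecompQuantumCell.BQPInPH) (hc : Nondeterministic.NP ⊆ Classes.P) :
    BQP ⊆ Classes.P :=
  (show BQP ⊆ PH from h).trans (lift_PH hc)

/-- TRANSFER ORDER of the two separations: `PP ⊄ BQP ⟹ PP ⊄ P`. [cite: BernsteinVazirani1997SICOMP, Thm. 8.2] -/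
theorem sep_P_of_sep_BQP (h : ¬ (PP ⊆ BQP)) : ¬ (PP ⊆ Classes.P) := fun hP => h (hP.trans p_subset_bqp)

/-! ## §4 The de-quantized twin: the `AWPP` cell (hypothesis-free) -/

/-- **THE AWPP CELL, EXACT**: `K ⟺ (NP ⊆ P → AWPP ⊆ P) ∧ (NP ⊆ P → PP ⊆ AWPP)`. [cite: Fenner2003, Cor. 3.2] -/
theorem awSandwich_iff : RootDecompSpaceCeiling.CollapseLift ↔
    (Nondeterministic.NP ⊆ Classes.P → AWPP ⊆ Classes.P) ∧ RootDecompQuantumCell.AWCatch :=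
  sandwich_iff p_subset_awpp awpp_subset_pp

/-- The classical lift implies the body of `QLift`. [cite: Fenner2003, Cor. 3.2] -/
theorem bqp_subset_P_of_awLift (h : Nondeterministic.NP ⊆ Classes.P → AWPP ⊆ Classes.P)
    (hc : Nondeterministic.NP ⊆ Classes.P) : BQP ⊆ Classes.P :=
  bqp_subset_awpp.trans (h hc)

/-- ORDER of the pieces (packaged as one conjunction): K ⟹ QCatch ⟹ AWCatch, and K ⟹ QLift.
[cite: Fenner2003, Cor. 3.2] [cite: BernsteinVazirani1997SICOMP, Thm. 8.2] -/
theorem pieces_order :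
    (RootDecompSpaceCeiling.CollapseLift → RootDecompQuantumCell.QCatch) ∧
      (RootDecompQuantumCell.QCatch → RootDecompQuantumCell.AWCatch) ∧
      (RootDecompSpaceCeiling.CollapseLift → RootDecompQuantumCell.QLift) :=
  ⟨catch_of_k p_subset_bqp, fun h hc => (h hc).trans bqp_subset_awpp, lift_of_k bqp_subset_pp⟩

/-- CONTENT of the classical catch: inside Algorithmica it collapses the second counting level, `PP^PP ⊆ PP`
(every `PP` oracle becomes an `AWPP` oracle, and `AWPP` is low for `PP`). [cite: FortnowRogers1999JCSS, Thm. 3.3] -/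
theorem awCatch_collapses_PP_PP (h : RootDecompQuantumCell.AWCatch)
    (hc : Nondeterministic.NP ⊆ Classes.P) : (⋃ L ∈ PP, PPRel (Oracle.ofLanguage L)) ⊆ PP := by
  intro M hM
  simp only [Set.mem_iUnion] at hM
  obtain ⟨L, hL, hML⟩ := hM
  exact Literature.Computability.QuantumComplexity.AWPPLow.AWPP_low_PP L (h hc hL) hML

end Summit.PneNP.PneNP.Theorems.RootDecompCountingSandwichPort
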